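import Mathlib.Analysis.Fourier.FourierTransform
import Mathlib.MeasureTheory.Measure.Haar.InnerProductSpace
import Literature.Analysis.Fourier.FourierUniquenessL1

/-!
# Fourier uniqueness on `L¹(ℝⁿ)` in coordinates

The coordinate form of the uniqueness theorem for the Fourier transform on `L¹`
(`Literature.Analysis.Fourier.ae_eq_zero_of_forall_fourier_eq_zero`, stated there on a finite-dimensional
real inner product space): if `F : (σ → ℝ) → ℂ` is integrable for Lebesgue measure on `σ → ℝ` (`σ` a finite
type) and `∫ e^{−2πi x·ξ} F(x) dx = 0` for every `ξ : σ → ℝ`, then `F = 0` almost everywhere.  It is obtained by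
transport along the measure-preserving identification `EuclideanSpace ℝ σ ≃ᵐ (σ → ℝ)`
(`EuclideanSpace.volume_preserving_symm_measurableEquiv_toLp`), under which `⟪v, ξ⟫ = Σ_k v_k ξ_k` and the
Fourier integral `𝓕` becomes the displayed coordinate integral (`Real.fourier_eq'`).

This is the form in which "Fourier uniqueness" enters Folland's completeness proof for the Hermite functions
(*Harmonic Analysis in Phase Space*, §1.7 (vii): "... so by Fourier uniqueness `g(x)e^{−πx²} = 0` a.e., and
hence `g = 0`"), see `Literature.Analysis.SegalBargmann.FockHermiteComplete`.

## Contents (all proved)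

* `Literature.Analysis.Fourier.ae_eq_zero_of_integral_cexp_mul_eq_zero` — `F ∈ L¹(ℝ^σ)`,
  `∀ ξ, ∫ x, e^{−2πi Σ_k x_k ξ_k} F(x) dx = 0` ⇒ `F = 0` a.e.

## References

* E. M. Stein, G. Weiss, *Introduction to Fourier analysis on Euclidean spaces*, Princeton 1971, Ch. I §1
  (the `ℝⁿ` statement); Y. Katznelson, *An introduction to harmonic analysis*, 3rd ed., Cambridge 2004,
  Ch. VI §1.11 (on `ℝ`) — as in `FourierUniquenessL1`.
* [Folland1989] G. B. Folland, *Harmonic Analysis in Phase Space*, Annals of Mathematics Studies 122,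
  Princeton University Press, 1989, §1.7 (vii) (the use).

Filed under the LEAN-IN-TREE rule (2026-08-18) by seat pv05-g8 from the HodgeCM/PerL working package file
`HodgeCM/PerL34/FourierUniqueness.lean` (origin seat pv05-g5), keeping only the coordinate corollary: the
inner-product-space statement of that file is the tree's `FourierUniquenessL1` and is reused, not re-proved.
-/

set_option autoImplicit false

noncomputable section

open MeasureTheory Complex
open scoped Real FourierTransform RealInnerProductSpace

namespace Literature.Analysis.Fourier

variable {σ : Type*} [Fintype σ]

/-- **Fourier uniqueness on `L¹(ℝ^σ)`** in coordinates: if `F : (σ → ℝ) → ℂ` is integrable and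
`∫ e^{−2πi x·ξ} F(x) dx = 0` for every `ξ`, then `F = 0` a.e. (Lebesgue measure on `σ → ℝ`); transported
from `ae_eq_zero_of_forall_fourier_eq_zero` on `EuclideanSpace ℝ σ`. [folklore] -/
theorem ae_eq_zero_of_integral_cexp_mul_eq_zero {F : (σ → ℝ) → ℂ} (hF : Integrable F)
    (h0 : ∀ ξ : σ → ℝ, ∫ x : σ → ℝ, cexp (((-2 * π * ∑ k, x k * ξ k : ℝ) : ℂ) * I) * F x = 0) :
    F =ᵐ[volume] 0 := by
  -- move to `EuclideanSpace ℝ σ`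
  have hmp := EuclideanSpace.volume_preserving_symm_measurableEquiv_toLp σ
  have hemb := (MeasurableEquiv.toLp 2 (σ → ℝ)).symm.measurableEmbedding
  have hF' : Integrable (fun v : EuclideanSpace ℝ σ => F (WithLp.ofLp v)) :=
    (hmp.integrable_comp_emb hemb).mpr hF
  have hzero : ∀ ξ : EuclideanSpace ℝ σ, 𝓕 (fun v : EuclideanSpace ℝ σ => F (WithLp.ofLp v)) ξ = 0 := by
    intro ξ
    have hinner : ∀ v : EuclideanSpace ℝ σ, ⟪v, ξ⟫ = ∑ k, WithLp.ofLp v k * WithLp.ofLp ξ k := fun v => by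
      rw [PiLp.inner_apply]
      refine Finset.sum_congr rfl fun k _ => ?_
      simp [mul_comm]
    have hcomp : ∫ v : EuclideanSpace ℝ σ,
        cexp (((-2 * π * ∑ k, WithLp.ofLp v k * WithLp.ofLp ξ k : ℝ) : ℂ) * I) * F (WithLp.ofLp v) =
        ∫ x : σ → ℝ, cexp (((-2 * π * ∑ k, x k * WithLp.ofLp ξ k : ℝ) : ℂ) * I) * F x :=
      hmp.integral_comp' (f := (MeasurableEquiv.toLp 2 (σ → ℝ)).symm)
        (fun x : σ → ℝ => cexp (((-2 * π * ∑ k, x k * WithLp.ofLp ξ k : ℝ) : ℂ) * I) * F x)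
    rw [Real.fourier_eq']
    simp_rw [smul_eq_mul, hinner]
    rw [hcomp]
    exact h0 (WithLp.ofLp ξ)
  have hae := ae_eq_zero_of_forall_fourier_eq_zero hF' hzero
  -- transfer the a.e. statement back along the measure-preserving equivalence
  rw [← hmp.map_eq]
  exact hemb.ae_map_iff.mpr hae

end Literature.Analysis.Fourier

end
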